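import Summits.HodgeConjecture.HodgeConjecture.Theorems.NikulinTwinTransportSquareGlueFree
import Summits.HodgeConjecture.HodgeConjecture.Theorems.ELineTransportEClassOfSquareHodgeTypePreserving
import Summits.HodgeConjecture.HodgeConjecture.Theses.ELineTransport

/-!
# Route ELineTransport · `SquareHodgeOfEClass` (stmt-HodgeConjecture-19047) — PROVED, unconditionally

The Künneth bookkeeping piece `X₁` of the BC2 redirect of `IsogenyInvariance` (Varesco 2023, p. 8: "HC for
`X²` ⟺ `End_Hdg(T(X))` algebraic"): for a projective K3 surface `S` with an `E`-structure `J` on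
`H²(S(ℂ); ℂ)` (rational, `J² = m`, cup-self-adjoint, `+√m` on `H^{2,0}`) satisfying EX (every rational
type-preserving `ψ` is `a + bJ` on `T = NS^⊥` modulo `NS`), IF the class of `J` is algebraic THEN
`HodgeConjectureFor 4 (S ⊗ S)`. The registered line `birth_SquareHodgeOfEClass` reduces it to a marking of
`H²(S, ℤ)` (`stub_K3_marking`) and `b₁(S) = 0` (`stub_K3_b1`), both unavailable in the tree; this file
proves the item WITHOUT either, for every smooth projective surface in place of the K3 surface `S`, by
the marking-free bookkeeping of `NikulinTwinTransportSquareGlueFree*`: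

* `exists_algebraicClass_of_corrFst_of_EX` — the endomorphism theorem under EX: the action `u[z]_*` of a
  rational `(2,2)`-class `z` of `S × S` on `H²(S)` is `[Γ]_*` for an ALGEBRAIC `Γ`. EX applied to
  `F = u[z]_*` gives `F ≡ a + bJ` on `T` modulo `N = N¹H²`; the `N`-components vanish because `F` and `J`
  map `T` into `T` (`cupProduct_corrFst_eq_zero_of_orthogonal`; `J` is cup-self-adjoint and preserves `N`
  by Lefschetz `(1,1)`), so `F - a - bJ` kills `T` and is a divisor correspondence on `N`.
* `mem_algebraicClasses_two_of_EX` — rational `(2,2)`-classes on `S × S` are algebraic under EX and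
  "`J` algebraic" (`z - Γ` acts trivially on `H²`, hence is divisor-supported,
  `mem_supportedClasses_one_of_corrFst_eq_zero`; divisor-supported rational `(2,2)`-classes of a fourfold
  are algebraic, closed item `NodalSupport.DivisorInduction`).
* `squareHodgeOfEClass_proof : Theses.ELineTransport.SquareHodgeOfEClass` — the item; `J` is
  type-preserving by the landed `EClassOfSquareHodge.isOfHodgeType_map_of_cupSelfAdjoint` (rational,
  cup-self-adjoint, real scalar on `H^{2,0}`); other codimensions by Lefschetz `(1,1)` / hard Lefschetz.

No definition, no named-fact hypothesis, no sorry. Prover seat ring2-b02 (gen 47).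

References: Varesco, *Hodge similitudes and the Hodge conjecture for squares of K3 surfaces* (2023), §0.2
p. 3 and §2 p. 8; Huybrechts, *Motives of isogenous K3 surfaces* (2019), §1; Voisin, *Hodge Theory and
Complex Algebraic Geometry I*, Lemma 11.41, Thm. 11.30, Thm. 6.25; Deligne, Hodge III, Cor. 8.2.8.
-/

set_option linter.dupNamespace false

noncomputable section

namespace Summit.HodgeConjecture.HodgeConjecture.Theorems.NikulinTwinTransport.SquareGlueFree

open scoped Manifold
open CategoryTheory MonoidalCategory CartesianMonoidalCategory
open Literature.AlgebraicGeometry Literature.AlgebraicGeometry.Motives Literature.AlgebraicGeometry.HodgeTheory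
open Literature.AlgebraicTopology.SingularHomology

variable {S : SchemeOver ℂ}

/-- `Corr[μ, hS ; γ, y] = pr₁_*(pr₂^* y ∪ γ)` on `H²(S(ℂ); ℂ)`. Local notation only. -/
local notation3 (prettyPrint := false) "Corr[" μ ", " hS " ; " γ ", " y "]" =>
  complexGysin μ (IsSmoothProjective.tensor_holds hS hS) hS
    (SemiCartesianMonoidalCategory.fst _ _) (rfl : 2 * 1 + 2 * 2 + 2 * 2 = 2 * 1 + 2 * (2 + 2))
    (cupProduct (rfl : 2 * 1 + 2 * 2 = 2 * 1 + 2 * 2)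
      (complexBetti.map (SemiCartesianMonoidalCategory.snd _ _) (2 * 1) y) γ)

/-! ### The endomorphism theorem under EX -/

/-- **Under EX, the action of a rational `(2,2)`-class of `S × S` on `H²(S)` is induced by an algebraic
class.** `S` a smooth projective surface, `μ` an orientation family, `J` a rational, type-preserving,
cup-self-adjoint endomorphism of `H²(S(ℂ); ℂ)` whose class is algebraic (`J = [γ_J]_*`), and EX: every
rational type-preserving `ψ` satisfies `ψ v - (a v + b J v) ∈ N¹H²` for `v ∈ T = (N¹H²)^⊥`, some
`a, b ∈ ℚ`. Then every rational `(2,2)`-class `z` has an algebraic `Γ` with `[Γ]_* = [z]_*` on `H²(S)`: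
with `F = u[z]_*` rational and type-preserving (`exists_smul_complexGysin_isRationalClass`,
`isOfHodgeType_corrFst`) and `a, b` from EX, `F v - a v - b J v` lies in `N` and in `T` for `v ∈ T`
(`F`, `J` preserve `T`: `cupProduct_corrFst_eq_zero_of_orthogonal`, self-adjointness and Lefschetz `(1,1)`),
so vanishes (`π_N` of bookkeeping I); on the rational divisor basis `dᵢ` it gives divisor classes `cᵢ`,
whence `Γ = u⁻¹(κ⁻¹ Σᵢ pr₁^* cᵢ ∪ pr₂^* dᵢ^∨ + a Δ + b γ_J)`. [cite: Varesco2023, §2 (p. 8)]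
[cite: VoisinHodgeI2002, §11.3.3 Lemma 11.41 and Thm. 11.30] -/
theorem exists_algebraicClass_of_corrFst_of_EX (μ : OrientationFamily) (hS : IsSmoothProjective 2 S)
    (J : complexBetti S (2 * 1) →ₗ[ℂ] complexBetti S (2 * 1))
    (hJ_rat : ∀ y, IsRationalClass y → IsRationalClass (J y))
    (hJ_typ : ∀ (i j : ℕ) y, IsOfHodgeType 2 S (2 * 1) i j y → IsOfHodgeType 2 S (2 * 1) i j (J y))
    (hJ_adj : ∀ x y : complexBetti S (2 * 1),
      cupProduct (rfl : 2 * 1 + 2 * 1 = 2 * 2) (J x) y = cupProduct (rfl : 2 * 1 + 2 * 1 = 2 * 2) x (J y))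
    (hγJ : ∃ γ ∈ algebraicClasses (S ⊗ S) 2, ∀ y : complexBetti S (2 * 1), J y = Corr[μ, hS ; γ, y])
    (hEX : ∀ (ψ : complexBetti S (2 * 1) →ₗ[ℂ] complexBetti S (2 * 1)),
      (∀ y, IsRationalClass y → IsRationalClass (ψ y)) →
      (∀ (i j : ℕ) y, IsOfHodgeType 2 S (2 * 1) i j y → IsOfHodgeType 2 S (2 * 1) i j (ψ y)) →
      ∃ a b : ℚ, ∀ v : complexBetti S (2 * 1),
        (∀ w ∈ algebraicClasses S 1, cupProduct (rfl : 2 * 1 + 2 * 1 = 2 * 2) v w = 0) →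
        ψ v - ((a : ℂ) • v + (b : ℂ) • J v) ∈ algebraicClasses S 1)
    {z : complexBetti (S ⊗ S) (2 * 2)} (hzQ : IsRationalClass z)
    (hzT : IsOfHodgeType (2 + 2) (S ⊗ S) (2 * 2) 2 2 z) :
    ∃ Γ ∈ algebraicClasses (S ⊗ S) 2, ∀ y : complexBetti S (2 * 1),
      Corr[μ, hS ; Γ, y] = Corr[μ, hS ; z, y] := by
  classical
  have h4 : 2 * 1 + 2 * 1 = 2 * 2 := rfl
  have hI := hodgePQ_independent_of_hodgeModel_holds
  have hdR : ∀ (E : Type) [NormedAddCommGroup E] [NormedSpace ℂ E] [FiniteDimensional ℂ E],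
      Literature.NumberTheory.Transcendental.exists_deRhamIsoFamily 𝓘(ℝ, E) :=
    fun E _ _ _ ↦ Literature.NumberTheory.Transcendental.exists_deRhamIsoFamily_holds E
  have hSS := IsSmoothProjective.tensor_holds hS hS
  obtain ⟨B, -⟩ := id hzT
  obtain ⟨A⟩ := nonempty_hodgeModel_holds (n := 2) (X := S) hS
  set N : Submodule ℂ (complexBetti S (2 * 1)) := algebraicClasses S 1 with hNdef
  have hN11 : ∀ d ∈ N, IsOfHodgeType 2 S (2 * 1) 1 1 d :=
    fun d hd ↦ isOfHodgeType_of_mem_algebraicClasses_of_isSmoothProjective hS 1 hd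
  have hL11 : ∀ c : complexBetti S (2 * 1), IsRationalClass c → IsOfHodgeType 2 S (2 * 1) 1 1 c → c ∈ N :=
    fun c hc h11 ↦ lefschetzOneOne_rational_holds hS c hc h11
  -- `J` preserves `N` (Lefschetz `(1,1)`) and `T`
  have hspan := span_isRationalClass_eq_top_of_isSmoothProjective_holds.supportedClasses_eq_span hS (2 * 1) 1
  have hJN : ∀ d ∈ N, J d ∈ N := by
    intro d hd
    have hd' : d ∈ Submodule.span ℂ {c : complexBetti S (2 * 1) |
        IsRationalClass c ∧ c ∈ supportedClasses S (2 * 1) 1} := by rw [← hspan]; exact hd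
    clear hd
    induction hd' using Submodule.span_induction with
    | mem c hc => exact hL11 _ (hJ_rat c hc.1) (hJ_typ 1 1 c (hN11 c hc.2))
    | zero => rw [map_zero]; exact Submodule.zero_mem _
    | add c c' _ _ hc hc' => rw [map_add]; exact Submodule.add_mem _ hc hc'
    | smul t c _ hc => rw [map_smul]; exact Submodule.smul_mem _ _ hc
  have hJT : ∀ y, (∀ d ∈ N, cupProduct h4 y d = 0) → ∀ d ∈ N, cupProduct h4 (J y) d = 0 :=
    fun y hy d hd ↦ by rw [hJ_adj, hy _ (hJN d hd)]
  -- the action of `z` on `H²(S)` as a linear map, rational up to `u`, type-preserving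
  let Fc : complexBetti S (2 * 1) →ₗ[ℂ] complexBetti S (2 * 1) :=
    (complexGysin μ hSS hS (fst S S) (rfl : 2 * 1 + 2 * 2 + 2 * 2 = 2 * 1 + 2 * (2 + 2))) ∘ₗ
      ((cupProduct (rfl : 2 * 1 + 2 * 2 = 2 * 1 + 2 * 2)).flip z) ∘ₗ (complexBetti.map (snd S S) (2 * 1)).hom
  have hFc : ∀ y, Fc y = Corr[μ, hS ; z, y] := fun y ↦ rfl
  obtain ⟨u, hu0, hu⟩ := exists_smul_complexGysin_isRationalClass μ hSS hS (fst S S)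
    (rfl : 2 * 1 + 2 * 2 + 2 * 2 = 2 * 1 + 2 * (2 + 2))
  set F : complexBetti S (2 * 1) →ₗ[ℂ] complexBetti S (2 * 1) := u • Fc with hFdef
  have hF : ∀ y, F y = u • Corr[μ, hS ; z, y] := fun y ↦ rfl
  have hF_rat : ∀ y, IsRationalClass y → IsRationalClass (F y) := fun y hy ↦ by
    rw [hF]
    exact hu _ (IsRationalClass.cup _ (IsRationalClass.map _ hy) hzQ)
  have hF_typ : ∀ (i j : ℕ) y, IsOfHodgeType 2 S (2 * 1) i j y → IsOfHodgeType 2 S (2 * 1) i j (F y) :=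
    fun i j y hy ↦ by
      rw [hF]
      exact (isOfHodgeType_corrFst hI hdR μ hS hS B A (rfl : 2 * 1 + 2 * 2 = 2 * 1 + 2 * 2)
        (rfl : 2 * 1 + 2 * 2 + 2 * 2 = 2 * 1 + 2 * (2 + 2)) hzT (rfl : i + 2 = i + 2) (rfl : j + 2 = j + 2)
        hy).smul u
  have hF_T : ∀ y, (∀ d ∈ N, cupProduct h4 y d = 0) → ∀ d ∈ N, cupProduct h4 (F y) d = 0 := by
    intro y hy d hd
    rw [hF, map_smul, LinearMap.smul_apply, cupProduct_corrFst_eq_zero_of_orthogonal μ hS hzQ hzT hy hd,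
      smul_zero]
  -- EX for `F`, and the Néron–Severi projection
  obtain ⟨a, b, hab⟩ := hEX F hF_rat hF_typ
  obtain ⟨π, hπN, hπid, hπT, hπorth, hπQ, hπtyp⟩ := exists_nsProjection_free hS
  -- on `T`: `F = a + b J`
  have hFT : ∀ y, (∀ d ∈ N, cupProduct h4 y d = 0) → F y = (a : ℂ) • y + (b : ℂ) • J y := by
    intro y hy
    have hx : F y - ((a : ℂ) • y + (b : ℂ) • J y) ∈ N := hab y hy
    have h1 : π (F y - ((a : ℂ) • y + (b : ℂ) • J y)) = F y - ((a : ℂ) • y + (b : ℂ) • J y) := hπid _ hx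
    rw [map_sub, map_add, map_smul, map_smul, hπT _ (hF_T y hy), hπT y hy, hπT _ (hJT y hy), smul_zero,
      smul_zero, add_zero, sub_zero] at h1
    exact (sub_eq_zero.1 h1.symm)
  -- `F₁ = F - a - b J` kills `T`
  set F₁ : complexBetti S (2 * 1) →ₗ[ℂ] complexBetti S (2 * 1) :=
    F - (a : ℂ) • LinearMap.id - (b : ℂ) • J with hF₁def
  have hF₁ : ∀ y, F₁ y = F y - (a : ℂ) • y - (b : ℂ) • J y := fun y ↦ by
    simp only [hF₁def, LinearMap.sub_apply, LinearMap.smul_apply, LinearMap.id_apply]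
  have hF₁T : ∀ y, (∀ d ∈ N, cupProduct h4 y d = 0) → F₁ y = 0 := fun y hy ↦ by
    rw [hF₁, hFT y hy, add_sub_cancel_left, sub_self]
  -- a rational basis of `N` with its Gram inverse, the classes `cᵢ = F₁ dᵢ ∈ N` and the dual basis
  obtain ⟨r, d, M, hdQ, hdN, hdli, hspanN, hmulinv, hinvmul⟩ := exists_neronSeveri_gramBasis hS
  have hmemS : ∀ x ∈ N, x ∈ Submodule.span ℂ (Set.range d) := fun x hx ↦ by rw [hspanN]; exact hx
  set c : Fin r → complexBetti S (2 * 1) := fun i ↦ F₁ (d i) with hcdef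
  have hcQ : ∀ i, IsRationalClass (c i) := fun i ↦ by
    simp only [hcdef, hF₁]
    exact isRationalClass_sub (isRationalClass_sub (hF_rat _ (hdQ i)) ((hdQ i).smul a))
      ((hJ_rat _ (hdQ i)).smul b)
  have hc11 : ∀ i, IsOfHodgeType 2 S (2 * 1) 1 1 (c i) := fun i ↦ by
    simp only [hcdef, hF₁]
    exact ((hF_typ 1 1 _ (hN11 _ (hdN i))).sub hS ((hN11 _ (hdN i)).smul _)).sub hS
      ((hJ_typ 1 1 _ (hN11 _ (hdN i))).smul _)
  have hcN : ∀ i, c i ∈ N := fun i ↦ hL11 _ (hcQ i) (hc11 i)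
  set dv : Fin r → complexBetti S (2 * 1) := fun i ↦ ∑ j, ((M i j : ℚ) : ℂ) • d j with hdvdef
  have hdvN : ∀ i, dv i ∈ N := fun i ↦ Submodule.sum_mem _ fun j _ ↦ Submodule.smul_mem _ _ (hdN j)
  -- the linear map `G₁ y = Σᵢ (∫ y ∪ dᵢ^∨) cᵢ` equals `F₁`
  have hsymm : ∀ x y : complexBetti S (2 * 1), cupProduct h4 x y = cupProduct h4 y x := fun x y ↦ by
    rw [cupProduct_gradedComm_holds ℂ _ h4 h4]
    norm_num
  have htdv : ∀ i k, traceC hS (cupProduct h4 (d k) (dv i)) = if i = k then 1 else 0 := by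
    intro i k
    simp only [hdvdef, map_sum, map_smul, smul_eq_mul]
    rw [← hinvmul i k]
    refine Finset.sum_congr rfl fun j _ ↦ ?_
    rw [hsymm (d k) (d j)]
  let G₁ : complexBetti S (2 * 1) →ₗ[ℂ] complexBetti S (2 * 1) :=
    ∑ i, ((traceC hS) ∘ₗ ((cupProduct h4).flip (dv i))).smulRight (c i)
  have hG₁ : ∀ y, G₁ y = ∑ i, traceC hS (cupProduct h4 y (dv i)) • c i := fun y ↦ by
    simp only [G₁, LinearMap.sum_apply, LinearMap.smulRight_apply, LinearMap.comp_apply,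
      LinearMap.flip_apply]
  have hG₁d : ∀ k, G₁ (d k) = F₁ (d k) := fun k ↦ by
    rw [hG₁]
    simp_rw [htdv]
    simp [ite_smul, Finset.sum_ite_eq', hcdef]
  have hG₁N : ∀ x ∈ N, G₁ x = F₁ x := by
    intro x hx
    refine Submodule.span_induction (p := fun x _ ↦ G₁ x = F₁ x) ?_ ?_ ?_ ?_ (hmemS x hx)
    · rintro _ ⟨k, rfl⟩
      exact hG₁d k
    · rw [map_zero, map_zero]
    · intro x y _ _ hx hy
      rw [map_add, map_add, hx, hy]
    · intro t x _ hx
      rw [map_smul, map_smul, hx]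
  have hG₁T : ∀ y, (∀ d ∈ N, cupProduct h4 y d = 0) → G₁ y = 0 := fun y hy ↦ by
    rw [hG₁]
    exact Finset.sum_eq_zero fun i _ ↦ by rw [hy _ (hdvN i), map_zero, zero_smul]
  have hG₁F₁ : ∀ y, G₁ y = F₁ y := fun y ↦ by
    have hy : y = π y + (y - π y) := by abel
    rw [hy, map_add, map_add, hG₁N _ (hπN y), hG₁T _ (hπorth y), hF₁T _ (hπorth y)]
  -- fibre integration
  obtain ⟨ω, hω⟩ := exists_traceC_eq_one hS
  have hω0 : ω ≠ 0 := by
    rintro rfl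
    rw [map_zero] at hω
    exact zero_ne_one hω
  obtain ⟨κ, hκ0, hκ⟩ := exists_fibreIntegral_fst μ hS hS (kunnethSpan_complexBetti hS hS (2 * (2 + 2)))
    hω0 (rfl : 2 * 2 + 2 * 2 = 0 + 2 * (2 + 2))
  -- the algebraic class `Γ₁ = Σᵢ pr₁^* cᵢ ∪ pr₂^* dᵢ^∨` acts as `κ G₁`
  set Γ₁ : complexBetti (S ⊗ S) (2 * 2) :=
    ∑ i, cupProduct h4 (complexBetti.map (fst S S) (2 * 1) (c i)) (complexBetti.map (snd S S) (2 * 1) (dv i))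
    with hΓ₁def
  have hΓ₁alg : Γ₁ ∈ algebraicClasses (S ⊗ S) 2 :=
    Submodule.sum_mem _ fun i _ ↦
      cupProduct_fst_snd_mem_algebraicClasses_of_eq hS hS (hcN i) (hdvN i) (rfl : 1 + 1 = 2) h4
  have hΓ₁act : ∀ y, Corr[μ, hS ; Γ₁, y] = κ • G₁ y := by
    intro y
    rw [hG₁, Finset.smul_sum, hΓ₁def, map_sum, map_sum]
    refine Finset.sum_congr rfl fun i _ ↦ ?_
    rw [corrFst_cross_of_cup_eq μ hS hS h4 (rfl : 2 * 1 + 2 * 2 = 2 * 1 + 2 * 2) h4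
      (rfl : 2 * 1 + 2 * 2 + 2 * 2 = 2 * 1 + 2 * (2 + 2)) (rfl : 2 * 2 + 2 * 2 = 0 + 2 * (2 + 2)) hκ
      (c i) (eq_traceC_smul hS hω (cupProduct h4 y (dv i))), smul_smul]
    congr 1
    rw [show ((-1 : ℂ) ^ (2 * 1 * (2 * 1))) = 1 by norm_num, one_mul, mul_comm]
  -- the diagonal and the class of `J`
  obtain ⟨γ, hγalg, hγ⟩ := hγJ
  set δ : complexBetti (S ⊗ S) (2 * 2) :=
    complexGysin μ hS hSS (lift (𝟙 S) (𝟙 S)) (rfl : 0 + 2 * (2 + 2) = 2 * 2 + 2 * 2)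
      (singularCohomology.one ℂ (ComplexPoints S)) with hδdef
  have hδalg : δ ∈ algebraicClasses (S ⊗ S) 2 := diagonal_mem_algebraicClasses μ hS _
  have hδact : ∀ y : complexBetti S (2 * 1), Corr[μ, hS ; δ, y] = y := fun y ↦
    corrFst_diagonal μ hS (rfl : 2 * 1 + 2 * 2 = 2 * 1 + 2 * 2)
      (rfl : 2 * 1 + 2 * 2 + 2 * 2 = 2 * 1 + 2 * (2 + 2)) (rfl : 0 + 2 * (2 + 2) = 2 * 2 + 2 * 2) y
  refine ⟨u⁻¹ • (κ⁻¹ • Γ₁ + (a : ℂ) • δ + (b : ℂ) • γ), Submodule.smul_mem _ _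
    (Submodule.add_mem _ (Submodule.add_mem _ (Submodule.smul_mem _ _ hΓ₁alg) (Submodule.smul_mem _ _ hδalg))
      (Submodule.smul_mem _ _ hγalg)), fun y ↦ ?_⟩
  have hlin : Corr[μ, hS ; u⁻¹ • (κ⁻¹ • Γ₁ + (a : ℂ) • δ + (b : ℂ) • γ), y] =
      u⁻¹ • (κ⁻¹ • Corr[μ, hS ; Γ₁, y] + (a : ℂ) • Corr[μ, hS ; δ, y] + (b : ℂ) • Corr[μ, hS ; γ, y]) := by
    simp only [map_add, map_smul]
  rw [hlin, hΓ₁act, hδact, ← hγ y, smul_smul, inv_mul_cancel₀ hκ0, one_smul, hG₁F₁, hF₁]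
  have hFy : F y = u • Corr[μ, hS ; z, y] := hF y
  rw [show F y - (a : ℂ) • y - (b : ℂ) • J y + (a : ℂ) • y + (b : ℂ) • J y = F y by abel, hFy, smul_smul,
    inv_mul_cancel₀ hu0, one_smul]

/-- **Rational `(2,2)`-classes on `S × S` are algebraic under EX and "`J` algebraic"**, for every smooth
projective surface `S`: `z - Γ` acts trivially on `H²(S)` for the algebraic `Γ` of
`exists_algebraicClass_of_corrFst_of_EX`, hence is supported on a divisor
(`mem_supportedClasses_one_of_corrFst_eq_zero`), so `z ∈ N¹H⁴`, and a rational `(2,2)`-class of a fourfold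
supported on a divisor is algebraic (`PgOneProductClasses.mem_algebraicClasses_two_of_mem_supportedClasses_one`).
[cite: Varesco2023, §2 (p. 8)] [cite: DeligneHodgeIII1974, Cor. 8.2.8] -/
theorem mem_algebraicClasses_two_of_EX (μ : OrientationFamily) (hS : IsSmoothProjective 2 S)
    (J : complexBetti S (2 * 1) →ₗ[ℂ] complexBetti S (2 * 1))
    (hJ_rat : ∀ y, IsRationalClass y → IsRationalClass (J y))
    (hJ_typ : ∀ (i j : ℕ) y, IsOfHodgeType 2 S (2 * 1) i j y → IsOfHodgeType 2 S (2 * 1) i j (J y))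
    (hJ_adj : ∀ x y : complexBetti S (2 * 1),
      cupProduct (rfl : 2 * 1 + 2 * 1 = 2 * 2) (J x) y = cupProduct (rfl : 2 * 1 + 2 * 1 = 2 * 2) x (J y))
    (hγJ : ∃ γ ∈ algebraicClasses (S ⊗ S) 2, ∀ y : complexBetti S (2 * 1), J y = Corr[μ, hS ; γ, y])
    (hEX : ∀ (ψ : complexBetti S (2 * 1) →ₗ[ℂ] complexBetti S (2 * 1)),
      (∀ y, IsRationalClass y → IsRationalClass (ψ y)) →
      (∀ (i j : ℕ) y, IsOfHodgeType 2 S (2 * 1) i j y → IsOfHodgeType 2 S (2 * 1) i j (ψ y)) →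
      ∃ a b : ℚ, ∀ v : complexBetti S (2 * 1),
        (∀ w ∈ algebraicClasses S 1, cupProduct (rfl : 2 * 1 + 2 * 1 = 2 * 2) v w = 0) →
        ψ v - ((a : ℂ) • v + (b : ℂ) • J v) ∈ algebraicClasses S 1)
    {z : complexBetti (S ⊗ S) (2 * 2)} (hzQ : IsRationalClass z)
    (hzT : IsOfHodgeType (2 + 2) (S ⊗ S) (2 * 2) 2 2 z) :
    z ∈ algebraicClasses (S ⊗ S) 2 := by
  have hX : IsSmoothProjective 4 (S ⊗ S) := IsSmoothProjective.tensor_holds hS hS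
  obtain ⟨Γ, hΓalg, hΓ⟩ := exists_algebraicClass_of_corrFst_of_EX μ hS J hJ_rat hJ_typ hJ_adj hγJ hEX hzQ hzT
  have hw : ∀ y : complexBetti S (2 * 1), Corr[μ, hS ; z - Γ, y] = 0 := fun y ↦ by
    rw [map_sub, map_sub, hΓ y, sub_self]
  have hN : z - Γ ∈ supportedClasses (S ⊗ S) (2 * 2) 1 := mem_supportedClasses_one_of_corrFst_eq_zero μ hS hw
  have hΓN : Γ ∈ supportedClasses (S ⊗ S) (2 * 2) 1 := supportedClasses_mono (S ⊗ S) (2 * 2) one_le_two hΓalg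
  have hz : z ∈ supportedClasses (S ⊗ S) (2 * 2) 1 := by
    have h := Submodule.add_mem _ hN hΓN
    rwa [sub_add_cancel] at h
  exact PgOneProductClasses.mem_algebraicClasses_two_of_mem_supportedClasses_one hX z hzQ hzT hz

/-! ### The item -/

/-- **`SquareHodgeOfEClass` (stmt-HodgeConjecture-19047), PROVED with no named-fact hypothesis**: for a
projective K3 surface `S` (only `IsSmoothProjective 2 S` is used), `m` non-square (unused), an
`E`-structure `J` on `H²(S(ℂ); ℂ)` satisfying EX, if the class of `J` is algebraic then
`HodgeConjectureFor 4 (S ⊗ S)`. `J` is type-preserving (`EClassOfSquareHodge.isOfHodgeType_map_of_cupSelfAdjoint`: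
rational, cup-self-adjoint, real scalar `√m` on `H^{2,0}`); codimension `2` is `mem_algebraicClasses_two_of_EX`;
the other codimensions by Lefschetz `(1,1)` and hard Lefschetz (`hodgeClasses_algebraic_fourfold_of_hodgeTwoTwo`);
a Hodge model of `S ⊗ S` exists (`nonempty_hodgeModel_holds`). Neither a marking of `H²(S, ℤ)` nor
`b₁(S) = 0` is needed. [cite: Varesco2023, §0.2 (p. 3) and §2 (p. 8)] [cite: VoisinHodgeI2002, Thm. 11.30 and Thm. 6.25]
[cite: DeligneHodgeIII1974, Cor. 8.2.8] -/
theorem squareHodgeOfEClass_proof : Theses.ELineTransport.SquareHodgeOfEClass := by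
  intro μ _hμ S hS m _hm J hJ hEX hγJ
  obtain ⟨hJrat, -, hJadj, hJ20⟩ := hJ
  have hX : IsSmoothProjective 4 (S ⊗ S) := IsSmoothProjective.tensor_holds hS.1 hS.1
  have hJtyp := EClassOfSquareHodge.isOfHodgeType_map_of_cupSelfAdjoint hS.1 J hJrat hJadj (Real.sqrt m) hJ20
  exact ⟨nonempty_hodgeModel_holds hX, fun p c hc hH ↦
    hodgeClasses_algebraic_fourfold_of_hodgeTwoTwo lefschetzOneOne_rational_holds
      (nonempty_hardLefschetzNFold_holds 4 (S ⊗ S)) hX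
      (fun c' hc' hH' ↦ mem_algebraicClasses_two_of_EX μ hS.1 J hJrat hJtyp hJadj hγJ hEX hc' hH') p c hc hH⟩

end Summit.HodgeConjecture.HodgeConjecture.Theorems.NikulinTwinTransport.SquareGlueFree

end
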